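import Summits.KontsevichZagierPeriods.KontsevichZagierPeriods.Theses.FermatIsogeny
import Summits.KontsevichZagierPeriods.KontsevichZagierPeriods.Theorems.GammaHodgeSector.Negative.Canonical
import Literature.NumberTheory.Transcendental.KZCubeProducts

/-!
# `BetaProductSector` (stmt-KontsevichZagierPeriods-3898), line `birth` — stub `stub_productValue`

The VALUE seam of the birth skeleton of the crux `BetaProductSector` (route FermatIsogeny, rank 4):
a Kontsevich–Zagier integral representation pinned as
`[(0,1)², c · x^{a-1}(1-x)^{b-1} · y^{e-1}(1-y)^{d-1}]` (`0 < a, b, e, d` rational, `c` an ARBITRARY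
real constant) has value `c · Γ(a)Γ(b)/Γ(a+b) · Γ(e)Γ(d)/Γ(e+d)`.

Proof: `r.value = ∫_{r.domain} r.integrand`; on the open square the integrand is `c` times the cube
Beta integrand `cubeFun ![a,e] ![b,d]` (`setIntegral_congr_fun`), the constant comes out
(`integral_const_mul`), and the remaining integral is literally the value of the canonical cube
representation `cubeRep ![a,e] ![b,d]`, which is `B(a,b) · B(e,d)` (`cubeRep_value`, Fubini + Euler's
Beta integral), with `B(α,β) = Γ(α)Γ(β)/Γ(α+β)` Mathlib's `ProbabilityTheory.beta` by definition.
-/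

noncomputable section

open MeasureTheory Set

namespace Summit.KontsevichZagierPeriods.FermatIsogeny.BetaProductSectorStubs

open Literature.NumberTheory.Transcendental
open Literature.NumberTheory.Transcendental.KZ
open Summit.KontsevichZagierPeriods.GammaHodgeSectorNegative (cubeRep cubeRep_value cubeFun cubeDom)

/-- Positivity of the exponent data `(![a,e], ![b,d])` of the pinned product word `((a,b),(e,d))`.
[folklore] -/
theorem pos_vec {a b e d : ℚ} (ha : 0 < a) (hb : 0 < b) (he : 0 < e) (hd : 0 < d) :
    ∀ j : Fin 2, 0 < (![a, e] : Fin 2 → ℚ) j ∧ 0 < (![b, d] : Fin 2 → ℚ) j :=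
  Fin.forall_fin_two.2 ⟨⟨ha, hb⟩, ⟨he, hd⟩⟩

/-- The value of the canonical cube representation of `(![a,e], ![b,d])` in the Γ-spelling of the crux:
`Γ(a)Γ(b)/Γ(a+b) · Γ(e)Γ(d)/Γ(e+d)`. [cite: KontsevichZagier2001, §1.1] -/
theorem cubeRep_two_value {a b e d : ℚ} (ha : 0 < a) (hb : 0 < b) (he : 0 < e) (hd : 0 < d) :
    (cubeRep ![a, e] ![b, d] (pos_vec ha hb he hd)).value =
      (Real.Gamma a * Real.Gamma b / Real.Gamma ((a:ℝ) + b)) *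
        (Real.Gamma e * Real.Gamma d / Real.Gamma ((e:ℝ) + d)) := by
  rw [cubeRep_value]
  simp only [Fin.prod_univ_two, Matrix.cons_val_zero, Matrix.cons_val_one, ProbabilityTheory.beta]

/-- **Stub `stub_productValue` — value of a pinned product representation.** A representation with
domain the open unit square and integrand `c · x^{a-1}(1-x)^{b-1} · y^{e-1}(1-y)^{d-1}` on it
(`0 < a, b, e, d` rational, `c` any real) has value `c · Γ(a)Γ(b)/Γ(a+b) · Γ(e)Γ(d)/Γ(e+d)`: the constant
comes out of the integral and the rest is the value `B(a,b)B(e,d)` of the canonical cube Beta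
representation (Fubini on the square and Euler's Beta integral). [cite: KontsevichZagier2001, §1.1] -/
theorem stub_productValue : ∀ (a b e d : ℚ) (c : ℝ), 0 < a → 0 < b → 0 < e → 0 < d → ∀ (r : Literature.NumberTheory.Transcendental.KZ.IntegralRep 2), r.domain = {x | ∀ i, x i ∈ Set.Ioo (0:ℝ) 1} → Set.EqOn r.integrand (fun x => c * (x 0) ^ ((a:ℝ) - 1) * (1 - x 0) ^ ((b:ℝ) - 1) * (x 1) ^ ((e:ℝ) - 1) * (1 - x 1) ^ ((d:ℝ) - 1)) r.domain → r.value = c * ((Real.Gamma a * Real.Gamma b / Real.Gamma ((a:ℝ) + b)) * (Real.Gamma e * Real.Gamma d / Real.Gamma ((e:ℝ) + d))) := by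
  intro a b e d c ha hb he hd r hrd hri
  rw [← cubeRep_two_value ha hb he hd, IntegralRep.value, IntegralRep.value,
    show (cubeRep ![a, e] ![b, d] (pos_vec ha hb he hd)).domain = {x | ∀ i, x i ∈ Set.Ioo (0:ℝ) 1}
      from rfl,
    show (cubeRep ![a, e] ![b, d] (pos_vec ha hb he hd)).integrand = cubeFun ![a, e] ![b, d] from rfl,
    hrd, ← integral_const_mul]
  refine setIntegral_congr_fun (measurableSet_setOf_forall_apply_mem_Ioo 2) fun x hx => ?_
  rw [hri (by rw [hrd]; exact hx)]
  simp only [cubeFun, Fin.prod_univ_two, Matrix.cons_val_zero, Matrix.cons_val_one]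
  ring

end Summit.KontsevichZagierPeriods.FermatIsogeny.BetaProductSectorStubs

end
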